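import Mathlib
import Summits.KontsevichZagierPeriods.Zeta5Search.KDigitRaise
import Summits.KontsevichZagierPeriods.Zeta5Search.RhoResidueIdentitiesProof
import HarnessLib

/-!
# ζ(5) search — the translation term `corr_C(T)` VANISHES for the centre-companion configuration (DENOM-LAW D1, prover-d1 gen 15)

HONEST FRAMING: systematic search; no irrationality claim unless certified.  Cell `pub-zeta5`, track «DENOM-LAW» D1, seat `denom-prover-d1`
gen 15 (`denom-law/prover-d1/ATTEMPT-15.md` §5, §9).  Companion of `KDigitCentre` / `KDigitRaise`.  The three RESIDUE-TYPE SUMS of a type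
`T = (L, e)` — `S₁(T) = Σρ₁`, `S₂(T) = Σ(ρ₂ + iρ₁)`, `S₃(T) = Σ(ρ₃ + 2iρ₂ + i²ρ₁)` (gen-2 g9's `RhoResidueIdentities` in type form) — satisfy
`corr_C(T) = 2S₃ + 3S₂ + S₁` (`typeCCorr_eq`), transform under `Φ ↦ (η − c)Φ` as `S₁ ↦ S₂ − cS₁`, `S₂ ↦ S₃ − cS₂` (`sum_rho_one_of_rho_mul`,
`sum_rho_two_of_rho_mul`), and under the end raise `T ++ [1]` (`c = L+1`: `typeS1_snocOne`, `typeS2_snocOne`); for a REALISED level class they are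
the class sums of `RhoResidueIdentities` (`sum_rho_one_level`, `sum_rho_two_level`).  Consequence (`typeCCorr_eq_zero_of_companion`): if the
ODD-CENTRE class of type `T` (data `(η − L/2)Φ_T`) and a centre-free class of type `T ++ [1]` (data `(η − (L+1))Φ_T`) are both realised with
class exponent `≤ −3`, the realised identities give `S₂ − (L/2)S₁ = S₃ − (L/2)S₂ = 0` and `S₂ − (L+1)S₁ = S₃ − (L+1)S₂ = 0`, hence
`S₁ = S₂ = S₃ = 0` and `corr_C(T) = 0` — the residue identities for the UNREALISED type `T` by transport, no abstract residue theorem needed.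
Pure finite-sum algebra over `ℚ`; nothing here bears on irrationality, no γ, nothing about ζ(5); records in print UNMOVED.
-/

noncomputable section

open Finset PowerSeries

namespace Summit.KontsevichZagierPeriods.Zeta5Search.SecondOrder

open Summit.KontsevichZagierPeriods.Zeta5Search.DualSeries (InBox)
open Summit.KontsevichZagierPeriods.Zeta5Search.CasoratianValuation (InPolytope)
open Summit.KontsevichZagierPeriods.Zeta5Search.ClusterValuation
open Summit.KontsevichZagierPeriods.Zeta5Search.LevelClass (typeRho classSet_level level_injective level_mem classPoles_level)

variable {p : ℕ} [hp : Fact p.Prime]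

/-! ## §1 The residue-type sums of a type -/

/-- `S₁(T) := Σ_{poles i} ρ^T_{i,1}`. -/
def typeS1 (L : ℕ) (e : ℕ → ℤ) : ℚ :=
  ∑ i ∈ (range (L + 1)).filter (fun i => e i < 0), typeRho L e i 1

/-- `S₂(T) := Σ_{poles i} ([n_i ≥ 2] ρ^T_{i,2} + i ρ^T_{i,1})`. -/
def typeS2 (L : ℕ) (e : ℕ → ℤ) : ℚ :=
  ∑ i ∈ (range (L + 1)).filter (fun i => e i < 0),
    ((if e i ≤ -2 then typeRho L e i 2 else 0) + ((i : ℕ) : ℚ) * typeRho L e i 1)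

/-- `S₃(T) := Σ_{poles i} ([n_i ≥ 3] ρ^T_{i,3} + 2i [n_i ≥ 2] ρ^T_{i,2} + i² ρ^T_{i,1})`. -/
def typeS3 (L : ℕ) (e : ℕ → ℤ) : ℚ :=
  ∑ i ∈ (range (L + 1)).filter (fun i => e i < 0),
    ((if e i ≤ -3 then typeRho L e i 3 else 0) + 2 * ((i : ℕ) : ℚ) * (if e i ≤ -2 then typeRho L e i 2 else 0)
      + (((i : ℕ) : ℚ)) ^ 2 * typeRho L e i 1)

/-- **`corr_C(T) = 2S₃(T) + 3S₂(T) + S₁(T)`.** -/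
theorem typeCCorr_eq (L : ℕ) (e : ℕ → ℤ) : typeCCorr L e = 2 * typeS3 L e + 3 * typeS2 L e + typeS1 L e := by
  unfold typeCCorr typeS1 typeS2 typeS3
  rw [mul_sum, mul_sum, ← sum_add_distrib, ← sum_add_distrib]
  refine sum_congr rfl fun i _ => ?_
  by_cases h2 : e i ≤ -2
  · rw [if_pos h2, if_pos h2]
    by_cases h3 : e i ≤ -3
    · rw [if_pos h3, if_pos h3]; ring
    · rw [if_neg h3, if_neg h3]; ring
  · rw [if_neg h2, if_neg h2, if_neg (by omega), if_neg (by omega)]; ring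

/-! ## §2 The sums of a realised centre-free level class are the type sums -/

section Level

variable (b : ℕ → ℤ) {x L : ℕ} (hx : x < p) (hL : x + L * p ≤ (b 0).toNat) (hL' : (b 0).toNat < x + L * p + p)
include hx hL hL'

/-- `Σ_{poles q ∈ x} ρ_{q,1} = S₁(T)` for a centre-free level class of type `T`. -/
theorem sum_rho_one_level (e : ℕ → ℤ) (he : ∀ k ≤ L, netExp b (x + k * p) = e k) (hc : ¬ CentreIn b p x) :
    ∑ q ∈ classPoles b p x, classRho b p q 1 = typeS1 L e := by
  have hP : (classSet b p x).filter (fun q => netExp b q < 0) =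
      ((range (L + 1)).filter fun k => e k < 0).image fun k => x + k * p := classPoles_level b hx hL hL' e he
  unfold typeS1 classPoles
  rw [hP, sum_image (fun a _ c _ h => level_injective hp.out.pos x h)]
  refine sum_congr rfl fun k hk => ?_
  have hkL : k ≤ L := by have := mem_range.1 (mem_filter.1 hk).1; omega
  rw [LevelClass.classRho_level b hx hL hL' e he hc hkL]

/-- `Σ_{poles q ∈ x} ([n_q ≥ 2]ρ_{q,2} + ℓ_q ρ_{q,1}) = S₂(T)` for a centre-free level class of type `T`. -/
theorem sum_rho_two_level (e : ℕ → ℤ) (he : ∀ k ≤ L, netExp b (x + k * p) = e k) (hc : ¬ CentreIn b p x) :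
    ∑ q ∈ classPoles b p x, ((if netExp b q ≤ -2 then classRho b p q 2 else 0) + ((q / p : ℕ) : ℚ) * classRho b p q 1) = typeS2 L e := by
  have hP : (classSet b p x).filter (fun q => netExp b q < 0) =
      ((range (L + 1)).filter fun k => e k < 0).image fun k => x + k * p := classPoles_level b hx hL hL' e he
  unfold typeS2 classPoles
  rw [hP, sum_image (fun a _ c _ h => level_injective hp.out.pos x h)]
  refine sum_congr rfl fun k hk => ?_
  have hkL : k ≤ L := by have := mem_range.1 (mem_filter.1 hk).1; omega
  rw [he k hkL, level_div hx, LevelClass.classRho_level b hx hL hL' e he hc hkL, LevelClass.classRho_level b hx hL hL' e he hc hkL]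

end Level

/-! ## §3 The sums of a class with cofactor data `(η − c)Φ_T` -/

section RhoMul

variable (b : ℕ → ℤ) {x L : ℕ} (hx : x < p) (hL : x + L * p ≤ (b 0).toNat) (hL' : (b 0).toNat < x + L * p + p)
  (e : ℕ → ℤ) (he : ∀ k ≤ L, netExp b (x + k * p) = e k) (c : ℚ)
  (hrho : ∀ i ≤ L, e i < 0 → ∀ σ : ℕ, 1 ≤ σ → (σ : ℤ) ≤ -e i →
    classRho b p (x + i * p) σ = (((i : ℕ) : ℚ) - c) * typeRho L e i σ + (if (σ : ℤ) + 1 ≤ -e i then typeRho L e i (σ + 1) else 0))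
include hx hL hL' he hrho

/-- `Σρ₁ = S₂(T) − c·S₁(T)` for data `(η − c)Φ_T`. -/
theorem sum_rho_one_of_rho_mul : ∑ q ∈ classPoles b p x, classRho b p q 1 = typeS2 L e - c * typeS1 L e := by
  have hP : (classSet b p x).filter (fun q => netExp b q < 0) =
      ((range (L + 1)).filter fun k => e k < 0).image fun k => x + k * p := classPoles_level b hx hL hL' e he
  unfold typeS1 typeS2 classPoles
  rw [hP, sum_image (fun a _ c _ h => level_injective hp.out.pos x h), mul_sum, ← sum_sub_distrib]
  refine sum_congr rfl fun k hk => ?_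
  obtain ⟨hkr, hkneg⟩ := mem_filter.1 hk
  have hkL : k ≤ L := by have := mem_range.1 hkr; omega
  rw [hrho k hkL hkneg 1 (by norm_num) (by push_cast; omega)]
  by_cases h2 : e k ≤ -2
  · rw [if_pos (by push_cast; omega), if_pos h2]; ring
  · rw [if_neg (by push_cast; omega), if_neg h2]; ring

/-- `Σ([n ≥ 2]ρ₂ + ℓρ₁) = S₃(T) − c·S₂(T)` for data `(η − c)Φ_T`. -/
theorem sum_rho_two_of_rho_mul :
    ∑ q ∈ classPoles b p x, ((if netExp b q ≤ -2 then classRho b p q 2 else 0) + ((q / p : ℕ) : ℚ) * classRho b p q 1) =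
      typeS3 L e - c * typeS2 L e := by
  have hP : (classSet b p x).filter (fun q => netExp b q < 0) =
      ((range (L + 1)).filter fun k => e k < 0).image fun k => x + k * p := classPoles_level b hx hL hL' e he
  unfold typeS2 typeS3 classPoles
  rw [hP, sum_image (fun a _ c _ h => level_injective hp.out.pos x h), mul_sum, ← sum_sub_distrib]
  refine sum_congr rfl fun k hk => ?_
  obtain ⟨hkr, hkneg⟩ := mem_filter.1 hk
  have hkL : k ≤ L := by have := mem_range.1 hkr; omega
  rw [he k hkL, level_div hx, hrho k hkL hkneg 1 (by norm_num) (by push_cast; omega)]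
  by_cases h2 : e k ≤ -2
  · rw [if_pos h2, if_pos h2, if_pos (by push_cast; omega), hrho k hkL hkneg 2 (by norm_num) (by push_cast; omega)]
    by_cases h3 : e k ≤ -3
    · rw [if_pos (by push_cast; omega), if_pos h3]; ring
    · rw [if_neg (by push_cast; omega), if_neg h3]; ring
  · rw [if_neg h2, if_neg h2, if_neg (by push_cast; omega), if_neg (by omega)]; ring

end RhoMul

/-! ## §4 The sums under the end raise `T ++ [1]` -/

/-- `S₁(T ++ [1]) = S₂(T) − (L+1)·S₁(T)`. -/
theorem typeS1_snocOne (L : ℕ) (e : ℕ → ℤ) :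
    typeS1 (L + 1) (snocOne e L) = typeS2 L e - ((L + 1 : ℕ) : ℚ) * typeS1 L e := by
  unfold typeS1 typeS2
  rw [sum_filter, sum_filter, sum_filter, mul_sum, ← sum_sub_distrib, sum_range_succ,
    show snocOne e L (L + 1) = 1 by rw [snocOne, if_pos rfl], if_neg (by norm_num), add_zero]
  refine sum_congr rfl fun i hi => ?_
  have hiL : i ≤ L := by have := mem_range.1 hi; omega
  have hr : snocOne e L i = e i := by rw [snocOne, if_neg (by omega)]
  rw [hr]
  by_cases h0 : e i < 0
  · rw [if_pos h0, if_pos h0, if_pos h0, typeRho_snocOne e hiL (σ := 1) (by push_cast; omega)]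
    by_cases h2 : e i ≤ -2
    · rw [if_pos (by push_cast; omega), if_pos h2]; ring
    · rw [if_neg (by push_cast; omega), if_neg h2]; ring
  · rw [if_neg h0, if_neg h0, if_neg h0]; ring

/-- `S₂(T ++ [1]) = S₃(T) − (L+1)·S₂(T)`. -/
theorem typeS2_snocOne (L : ℕ) (e : ℕ → ℤ) :
    typeS2 (L + 1) (snocOne e L) = typeS3 L e - ((L + 1 : ℕ) : ℚ) * typeS2 L e := by
  unfold typeS2 typeS3
  rw [sum_filter, sum_filter, sum_filter, mul_sum, ← sum_sub_distrib, sum_range_succ,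
    show snocOne e L (L + 1) = 1 by rw [snocOne, if_pos rfl], if_neg (by norm_num), add_zero]
  refine sum_congr rfl fun i hi => ?_
  have hiL : i ≤ L := by have := mem_range.1 hi; omega
  have hr : snocOne e L i = e i := by rw [snocOne, if_neg (by omega)]
  rw [hr]
  by_cases h0 : e i < 0
  · rw [if_pos h0, if_pos h0, if_pos h0, typeRho_snocOne e hiL (σ := 1) (by push_cast; omega)]
    by_cases h2 : e i ≤ -2
    · rw [if_pos h2, if_pos h2, if_pos (by push_cast; omega), typeRho_snocOne e hiL (σ := 2) (by push_cast; omega)]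
      by_cases h3 : e i ≤ -3
      · rw [if_pos (by push_cast; omega), if_pos h3]; push_cast; ring
      · rw [if_neg (by push_cast; omega), if_neg h3]; push_cast; ring
    · rw [if_neg h2, if_neg h2, if_neg (by push_cast; omega), if_neg (by omega)]; push_cast; ring
  · rw [if_neg h0, if_neg h0, if_neg h0]; ring

/-! ## §5 `corr_C(T) = 0` by transport of the realised residue identities -/

/-- **`corr_C(T) = 0` for the centre-companion configuration.**  `T = (L, e)`; `x` the ODD-CENTRE class realising `T` (base `x < p`, levels
`0..L`, `b₀` odd, `CentreIn`) with `E_x ≤ −3`; `y` a centre-free class realising `T ++ [1]` (levels `0..L+1`) with `E_y ≤ −3`.  Then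
`typeCCorr L e = 0` (indeed `S₁(T) = S₂(T) = S₃(T) = 0`). -/
theorem typeCCorr_eq_zero_of_companion (b : ℕ → ℤ) (hb : InPolytope b) (hp5 : 5 ≤ p) (hwin : (b 0 + 2 : ℤ) < (p : ℤ) ^ 2)
    {x y L : ℕ} (hx : x < p) (hxL : x + L * p ≤ (b 0).toNat) (hxL' : (b 0).toNat < x + L * p + p)
    (hodd : ¬ (2 : ℤ) ∣ b 0) (hcen : CentreIn b p x) (hEx : classExp b p x ≤ -3)
    (hy : y < p) (hyL : y + (L + 1) * p ≤ (b 0).toNat) (hyL' : (b 0).toNat < y + (L + 1) * p + p) (hyc : ¬ CentreIn b p y)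
    (hEy : classExp b p y ≤ -3)
    (e : ℕ → ℤ) (hex : ∀ k ≤ L, netExp b (x + k * p) = e k) (hey : ∀ k ≤ L + 1, netExp b (y + k * p) = snocOne e L k) :
    typeCCorr L e = 0 := by
  -- realised residue identities
  obtain ⟨hx1, hx2, -⟩ := rhoResidueIdentities_holds b p x hb hp.out hp5 hwin hx
  obtain ⟨hy1, hy2, -⟩ := rhoResidueIdentities_holds b p y hb hp.out hp5 hwin hy
  have ex1 := hx1 (by omega)
  have ex2 := hx2 hEx
  have ey1 := hy1 (by omega)
  have ey2 := hy2 hEy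
  -- the centre class: data `(η − L/2)Φ_T`
  have hrx := fun (i : ℕ) (hi : i ≤ L) (hneg : e i < 0) (σ : ℕ) (_ : 1 ≤ σ) (hσ : (σ : ℤ) ≤ -e i) =>
    classRho_centre_level b hx hxL hxL' hodd hcen hb e hex hi hneg σ hσ
  rw [sum_rho_one_of_rho_mul b hx hxL hxL' e hex _ hrx] at ex1
  rw [sum_rho_two_of_rho_mul b hx hxL hxL' e hex _ hrx] at ex2
  -- the companion class: type `T ++ [1]`
  rw [sum_rho_one_level b hy hyL hyL' (snocOne e L) hey hyc, typeS1_snocOne] at ey1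
  rw [sum_rho_two_level b hy hyL hyL' (snocOne e L) hey hyc, typeS2_snocOne] at ey2
  -- linear algebra: `c = L/2` and `c′ = L+1` differ
  rw [typeCCorr_eq]
  have hS1 : typeS1 L e = 0 := by
    have h : ((L + 1 : ℕ) : ℚ) - (L : ℚ) / 2 ≠ 0 := by push_cast; linarith
    have h2 : (((L + 1 : ℕ) : ℚ) - (L : ℚ) / 2) * typeS1 L e = 0 := by linarith
    rcases mul_eq_zero.1 h2 with h3 | h3
    · exact absurd h3 h
    · exact h3
  have hS2 : typeS2 L e = 0 := by rw [hS1] at ex1; linarith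
  have hS3 : typeS3 L e = 0 := by rw [hS2] at ex2; linarith
  rw [hS1, hS2, hS3]; ring

end Summit.KontsevichZagierPeriods.Zeta5Search.SecondOrder

end
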